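import Summits.QuantumFields.YangMills.Theses.LangevinControlUV
import Summits.QuantumFields.YangMills.Theorems.HypercubicLimit.Negative.AllTimesGapFalse

/-!
# `LatticeGapInUVUnits` — negative-side support: the uniform-constant strengthening of the conclusion is false

Support file for crux `stmt-QuantumFields-9366` (`LangevinControlUV.LatticeGapInUVUnits`), extracted from the
standing disprover's work file `Cruxes/LatticeGapInUVUnits/Disproof.lean` (§7). Tree objects only; nothing is
posited and no definition is introduced.

The conclusion of the crux reads `∃ c₁ > 0, β₂, S₁, ∀ A B, ∃ C, ∀ β ≥ β₂, ∀ S ≥ S₁ β, ∀ n ≤ S,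
|corr_{β,2S+1}(A, B, n)| ≤ C e^{−c₁ a(β) n}`. The natural strengthening with ONE constant for all pairs of
observables (`∃ C, ∀ A B`) is FALSE for every non-abelian compact gauge group, every faithful `r` and every unit
map `a`:

* `latticeConnectedCorr_smul`: connected torus correlations are bilinear, `corr(tA, tB) = t² corr(A, B)`;
* `not_uniform_constant_clustering`: scale the curvature observable — `corr(tP, tP, 0) = t² Var_β(P)` with
  `Var_β(P) > 0` (tree `variance_pos`, `actionDensity_ne`: the Wilson measure charges open sets and `tr F²`
  separates the trivial configuration from an `ab ≠ ba` configuration) is unbounded in `t`;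
* `not_uniform_constant_clustering_of_simple`: in particular for every compact simple Lie group.

So the quantifier order `∀ A B, ∃ C` of the crux (and of `HasLatticeMassGap`) is load-bearing: provers must carry
observable-dependent constants (the norms `‖Φ(A)Ω‖`), never a uniform one. [folklore]
-/

namespace Summit.QuantumFields.YangMills.Theorems.LatticeGapInUVUnits.Negative

open Filter Topology MeasureTheory
open Literature.MathematicalPhysics.QuantumFieldTheory Literature.MathematicalPhysics.QuantumLattice
open Summit.QuantumFields.YangMills.Theorems.HypercubicLimit.Negative
  (variance_pos actionDensity_ne torusLift_dirConfigT torusLift_one latticeConnectedCorr_zero_time)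

noncomputable section

variable {G : Type} [Group G] [TopologicalSpace G] [IsTopologicalGroup G] [CompactSpace G]
  [MeasurableSpace G] [BorelSpace G]

/-- Connected torus correlations are bilinear: `corr(tA, tB) = t² corr(A, B)`. [folklore] -/
theorem latticeConnectedCorr_smul {N : ℕ} (ρ : G →* Matrix (Fin N) (Fin N) ℂ) (β : ℝ) (S : ℕ) [NeZero S]
    (t : ℝ) (A B : LGConfig 4 G → ℝ) (n : ℕ) :
    latticeConnectedCorr ρ β S (fun U => t * A U) (fun U => t * B U) n =
      t * t * latticeConnectedCorr ρ β S A B n := by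
  unfold latticeConnectedCorr
  have h1 : (fun U : GaugeConfig 4 S G =>
      t * A (torusLift S U) * (t * B (configShift (-Pi.single 0 (n : ℤ)) (torusLift S U)))) =
      fun U => (t * t) * (A (torusLift S U) * B (configShift (-Pi.single 0 (n : ℤ)) (torusLift S U))) := by
    funext U; ring
  rw [h1, integral_const_mul, integral_const_mul, integral_const_mul]
  ring

/-- **The uniform-constant strengthening of the crux's conclusion is FALSE for every non-abelian compact `G`**,
every faithful `r` and every unit map `a` (indeed for every rate `c₁`, threshold `β₂` and volume function `S₁`):
at `n = 0` the bound reads `t² Var_{β₂}(P) ≤ C` for the scaled curvature observable `tP`, all `t`, while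
`Var_{β₂}(P) > 0`. [folklore] -/
theorem not_uniform_constant_clustering (hG : ∃ g h : G, g * h ≠ h * g) (r : LatticeRep G) (a : ℝ → ℝ) :
    ¬ ∃ (c₁ β₂ C : ℝ) (S₁ : ℝ → ℕ), 0 < c₁ ∧ ∀ A B : YMSpecies G, ∀ β : ℝ, β₂ ≤ β → ∀ S n : ℕ,
      S₁ β ≤ S → n ≤ S →
        |latticeConnectedCorr r.ρ β (2 * S + 1) A.F B.F n| ≤ C * Real.exp (-(c₁ * a β * n)) := by
  rintro ⟨c₁, β₂, C, S₁, -, h⟩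
  obtain ⟨g₁, g₂, hg⟩ := hG
  set S := S₁ β₂ with hS
  -- the scaled curvature observable `t · tr F²`
  let obs : ℝ → YMSpecies G := fun t =>
    { F := fun U => t * r.curvature.F U
      supp := r.curvature.supp
      isCylinder := fun U V huv => by
        show t * r.curvature.F U = t * r.curvature.F V
        rw [r.curvature.isCylinder huv]
      gaugeInvariant := fun g U => by
        show t * r.curvature.F _ = t * r.curvature.F U
        rw [r.curvature.gaugeInvariant g U]
      bounded := by
        obtain ⟨K, hK⟩ := r.curvature.bounded
        exact ⟨|t| * K, fun U => by rw [abs_mul]; exact mul_le_mul_of_nonneg_left (hK U) (abs_nonneg t)⟩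
      measurable := r.curvature.measurable.const_mul t }
  have hobs : ∀ t, (obs t).F = fun U => t * r.curvature.F U := fun t => rfl
  have hP : Continuous fun W : GaugeConfig 4 (2 * S + 1) G => r.curvature.F (torusLift (2 * S + 1) W) :=
    (continuous_actionDensity r.continuous).comp (continuous_pi fun _ => continuous_apply _)
  have hne : r.curvature.F (torusLift (2 * S + 1)
      (fun e : Edge 4 (2 * S + 1) => if e.2 = 0 then g₁ else if e.2 = 1 then g₂ else (1 : G))) ≠
      r.curvature.F (torusLift (2 * S + 1) (fun _ => 1)) := by
    rw [torusLift_dirConfigT, torusLift_one]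
    exact actionDensity_ne r hg
  have hvar := variance_pos r β₂ (2 * S + 1) hP hne
  set v := ∫ W, r.curvature.F (torusLift (2 * S + 1) W) * r.curvature.F (torusLift (2 * S + 1) W)
        ∂(wilsonMeasure (d := 4) (L := 2 * S + 1) r.ρ β₂) -
      (∫ W, r.curvature.F (torusLift (2 * S + 1) W) ∂(wilsonMeasure (d := 4) (L := 2 * S + 1) r.ρ β₂)) *
        ∫ W, r.curvature.F (torusLift (2 * S + 1) W) ∂(wilsonMeasure (d := 4) (L := 2 * S + 1) r.ρ β₂) with hv
  have hle : ∀ t : ℝ, t * t * v ≤ C := fun t => by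
    have h0 := h (obs t) (obs t) β₂ le_rfl S 0 le_rfl (Nat.zero_le _)
    rw [hobs, latticeConnectedCorr_smul, latticeConnectedCorr_zero_time] at h0
    simp only [Nat.cast_zero, mul_zero, neg_zero, Real.exp_zero, mul_one] at h0
    exact (le_abs_self _).trans h0
  set t : ℝ := |C| / v + 1 with ht
  have ht1 : 1 ≤ t := by
    have : 0 ≤ |C| / v := div_nonneg (abs_nonneg C) hvar.le
    linarith
  have htv : t * v = |C| + v := by
    rw [ht, add_mul, one_mul, div_mul_cancel₀ _ hvar.ne']
  have hbig : |C| + v ≤ t * t * v := by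
    calc |C| + v = 1 * (t * v) := by rw [htv, one_mul]
      _ ≤ t * (t * v) := mul_le_mul_of_nonneg_right ht1 (by rw [htv]; positivity)
      _ = t * t * v := by ring
  have := hle t
  linarith [le_abs_self C]

/-- In particular for every compact simple Lie group (non-abelian by definition of `IsSimpleCompactGroup`).
[folklore] -/
theorem not_uniform_constant_clustering_of_simple (hG : IsCompactSimpleLieGroup G) (r : LatticeRep G)
    (a : ℝ → ℝ) :
    ¬ ∃ (c₁ β₂ C : ℝ) (S₁ : ℝ → ℕ), 0 < c₁ ∧ ∀ A B : YMSpecies G, ∀ β : ℝ, β₂ ≤ β → ∀ S n : ℕ,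
      S₁ β ≤ S → n ≤ S →
        |latticeConnectedCorr r.ρ β (2 * S + 1) A.F B.F n| ≤ C * Real.exp (-(c₁ * a β * n)) :=
  not_uniform_constant_clustering hG.1.2.1 r a

end

end Summit.QuantumFields.YangMills.Theorems.LatticeGapInUVUnits.Negative
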